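import Summits.KontsevichZagierPeriods.Zeta5Search.TwoTaleOmega.StepAEFRKit

/-!
# (bmiss)@Ω — the recurrence in direction `aef`, SECOND TALE, generic in the certificate, on the rule box (cell `pub-zeta5`, cert-2 gen 5)

HONEST FRAMING: systematic search; recurrence certificates; no irrationality claim unless certified. Pure finite algebra over `ℚ`;
no named fact, no `sorry`.

Blueprint `families/tele/RECURRENCE.md` §14.11 (B), side `R`, on cert-1 g4's template `StepAR`.  INPUT: the kit `StepAEFRKit` (Γ-ratio along
`δ_aef`, atoms, the closed-form data `GfAEFR X`, `GfAEFR_eq_cert`) and, as a HYPOTHESIS, the cleared identity `IdRb c X p` (block-atom form) of an arbitrary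
R-side operator `c : Fin 4 → ℚ` and certificate polynomial `X` (`deg ≤ 9`, lattice variable) — the shape of cert-2 g4's `telescope_aef<n>_R`.
Steps: function identity off `SaefR = [−4g, 6g+2]` by `telescope_assembly` (`σ_k = (−1)^k`), Lemma U, legitimacy at the COMMON NODE `M* = −(a+3)`
(simple zeros `(u+a+2)(u+a+3)` of the reduced u-block; not poles since `2e ≥ 2a−8 > a+3` on the box), node moves inside each point's
second-tale window.  OUTPUT `recR_aef` (truncation `0`).  Valid on the aef rule box `AefBox` (PROOF.md Thm S2 certifies side R of `aef` on the
rule domain only).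
-/

noncomputable section

open Finset Polynomial
open Literature.NumberTheory.Irrationality.Zudilin2014
open Summit.KontsevichZagierPeriods.Zeta5Search.FormalBarnes
open Summit.KontsevichZagierPeriods.Zeta5Search.Certificates.TwoTaleTelescope

namespace Summit.KontsevichZagierPeriods.Zeta5Search.TwoTaleOmega

namespace Pt

variable (p : Pt)

/-! ### Evaluating the atoms -/

/-- Blocks of length `4` and `6` evaluated. -/
theorem eval_block_46 (b : ℤ) (t : ℚ) :
    (block b (b + 4)).eval t = (t + b) * (t + b + 1) * (t + b + 2) * (t + b + 3) ∧
    (block b (b + 6)).eval t = (t + b) * (t + b + 1) * (t + b + 2) * (t + b + 3) * (t + b + 4) * (t + b + 5) := by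
  have h2 := (eval_block_123 b t).2.1
  have h2' := (eval_block_123 (b + 2) t).2.1
  have h3 := (eval_block_123 b t).2.2
  have h3' := (eval_block_123 (b + 3) t).2.2
  have e4 : block b (b + 4) = block b (b + 2) * block (b + 2) (b + 4) := by
    rw [block_mul_block (by omega) (by omega)]
  have e6 : block b (b + 6) = block b (b + 3) * block (b + 3) (b + 6) := by
    rw [block_mul_block (by omega) (by omega)]
  rw [show b + 2 + 2 = b + 4 by ring] at h2'
  rw [show b + 3 + 3 = b + 6 by ring] at h3'
  refine ⟨?_, ?_⟩
  · rw [e4, Polynomial.eval_mul, h2, h2']; push_cast; ring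
  · rw [e6, Polynomial.eval_mul, h3, h3']; push_cast; ring

/-! ### Atoms of the cleared identity in block-value form (the shape delivered by `vR_ratio_addAEF`) -/

/-- The `t`-free factors `∏_{j<k}(e+j)(f−a+e+j)(f+j)` of the Γ-ratio along `δ_aef` (from `κ`). -/
def P3 (k : ℕ) : ℚ :=
  (∏ j ∈ range k, ((p.e : ℚ) - 1 + j + 1)) * (∏ j ∈ range k, ((p.f : ℚ) - p.a + p.e - 1 + j + 1)) * (∏ j ∈ range k, ((p.f : ℚ) - 1 + j + 1))

/-- Numerator atom `n_k = P3 k · (u+g−b+a)_k (t+f)_k (t+e)_k (t+a)_k` as block values (`σ_k = (−1)^k` kept separate). -/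
def numRb (k : ℕ) (u : ℚ) : ℚ :=
  p.P3 k * ((block (p.g - p.b + p.a) (p.g - p.b + p.a + k)).eval u * (block p.f (p.f + k)).eval (u / 2)
    * (block p.e (p.e + k)).eval (u / 2) * (block p.a (p.a + k)).eval (u / 2))

/-- Denominator atom `d_k = (u+a+1)_k (t+a−b+1)_k (t+e+f)_{2k}` as block values. -/
def denRb (k : ℕ) (u : ℚ) : ℚ :=
  (block (p.a + 1) (p.a + 1 + k)).eval u * (block (p.a - p.b + 1) (p.a - p.b + 1 + k)).eval (u / 2)
    * (block (p.e + p.f) (p.e + p.f + 2 * k)).eval (u / 2)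

/-- `cnum` shifted by `u ↦ u+2` (definitionally). -/
def cnumS2 (u : ℚ) : ℚ := p.cnumR (u + 2)
/-- `cden` shifted by `u ↦ u+2` (definitionally). -/
def cdenS2 (u : ℚ) : ℚ := p.cdenR (u + 2)

/-- **The cleared second-tale telescoping identity of direction `aef`, block-atom form**, for the R-side operator `c` and a certificate
polynomial `X` in the lattice variable (`X(u) = x_R(a,u/2)`): `telescope_assembly`'s `hA` with `σ_k = (−1)^k`, `n_k = numRb k`, `d_k = denRb k`
and the kit's `tnR, tdR, cnumR, cdenR`.  (The kit's `IdR`/`numR`/`denR` spell the same identity with the factors written out; this form is the one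
the Γ-ratio lemma produces literally, so no expansion of long products is ever needed.) -/
def IdRb (c : Fin 4 → ℚ) (X : ℚ[X]) : Prop :=
  ∀ u : ℚ, (c 0 * p.denRb 1 u * p.denRb 2 u * p.denRb 3 u + (-1) ^ (1 : ℕ) * c 1 * p.numRb 1 u * p.denRb 2 u * p.denRb 3 u
      + (-1) ^ (2 : ℕ) * c 2 * p.numRb 2 u * p.denRb 1 u * p.denRb 3 u + (-1) ^ (3 : ℕ) * c 3 * p.numRb 3 u * p.denRb 1 u * p.denRb 2 u)
      * p.cdenS2 u * p.tdR u * p.cdenR u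
    = (p.cnumS2 u * X.eval (u + 2) * p.tnR u * p.cdenR u - p.cnumR u * X.eval u * p.cdenS2 u * p.tdR u)
      * (p.denRb 1 u * p.denRb 2 u * p.denRb 3 u)

/-- The exceptional set for Lemma U (second tale, direction `aef`). -/
def SaefR : Finset ℤ := Icc (-(4 * p.g)) (6 * p.g + 2)

variable {p}

/-- The Γ-ratio in atom form: `F_R(p+kδ;u)·d_k(u) = (−1)^k n_k(u)·F_R(p;u)`. -/
theorem vR_ratio_atoms (h : p.Omega) (k : ℕ) (hk : (p.addAEF k).Omega) {u : ℚ} (hu : ∀ K ∈ Icc 1 (6 * p.g), u + K ≠ 0) :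
    (p.addAEF k).vR.eval u * p.denRb k u = (-1) ^ k * p.numRb k u * p.vR.eval u := by
  have h' := vR_ratio_addAEF h k hk hu
  unfold denRb numRb P3
  rw [h']; ring

/-- The denominator atoms do not vanish off the lattice interval `[1, 5g]` (box inequalities). -/
theorem denRb_ne_zero (h : p.Omega) (hb : p.AefBox) (k : ℕ) (hk : k ≤ 3) {u : ℚ} (hu : ∀ K ∈ Icc 1 (6 * p.g), u + K ≠ 0) :
    p.denRb k u ≠ 0 := by
  obtain ⟨o1, o2, o3, o4, o5, o6, o7, o8, o9⟩ := h
  obtain ⟨b1, b2, b3, b4, b5, b6, b7, b8, b9, b10, b11, b12⟩ := hb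
  have hk' : (k : ℤ) ≤ 3 := by exact_mod_cast hk
  have half : ∀ lo hi : ℤ, 1 ≤ 2 * lo → 2 * hi ≤ 6 * p.g + 2 → (block lo hi).eval (u / 2) ≠ 0 := fun lo hi h1 h2 =>
    eval_block_ne_zero fun i hi heq => hu (2 * i) (by rw [mem_Ico] at hi; rw [mem_Icc]; omega)
      (by rw [show u = 2 * (u / 2) by ring, heq]; push_cast; ring)
  unfold denRb
  refine mul_ne_zero (mul_ne_zero ?_ (half _ _ (by omega) (by omega))) (half _ _ (by omega) (by omega))
  exact eval_block_ne_zero fun i hi heq => hu i (by rw [mem_Ico] at hi; rw [mem_Icc]; omega) (by rw [heq]; ring)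

/-! ### Step (2): the function identity -/

set_option maxHeartbeats 1600000 in
/-- **Function identity** `Σ_k C_k F_R(p+kδ_aef;u) = G(u+2) − G(u)` off the exceptional set `SaefR = [−4g, 6g+2]`, from `IdR`, on the box. -/
theorem funId_aefR {c : Fin 4 → ℚ} {X : ℚ[X]} (hc : p.IdRb c X) (hb : p.AefBox)
    (h0 : p.Omega) (h1 : (p.addAEF 1).Omega) (h2 : (p.addAEF 2).Omega) (h3 : (p.addAEF 3).Omega) {u : ℚ}
    (hu : ∀ K ∈ p.SaefR, u + K ≠ 0) :
    c 0 * p.vR.eval u + c 1 * (p.addAEF 1).vR.eval u + c 2 * (p.addAEF 2).vR.eval u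
      + c 3 * (p.addAEF 3).vR.eval u = (p.GfAEFR X).eval (u + 2) - (p.GfAEFR X).eval u := by
  have hp := h0.pos
  obtain ⟨o1, o2, o3, o4, o5, o6, o7, o8, o9⟩ := id h0
  obtain ⟨b1, b2, b3, b4, b5, b6, b7, b8, b9, b10, b11, b12⟩ := id hb
  have nz : ∀ K : ℤ, -(4 * p.g) ≤ K → K ≤ 6 * p.g + 2 → u + K ≠ 0 := fun K hK1 hK2 => hu K (by unfold SaefR; rw [mem_Icc]; omega)
  have hu6 : ∀ K ∈ Icc 1 (6 * p.g), u + K ≠ 0 := fun K hK => by rw [mem_Icc] at hK; exact nz K (by omega) (by omega)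
  have hu6' : ∀ K ∈ Icc 1 (6 * p.g), u + 2 + K ≠ 0 := fun K hK => by
    rw [mem_Icc] at hK; have := nz (K + 2) (by omega) (by omega); push_cast at this; rwa [add_assoc, add_comm (2:ℚ)]
  have hu4 : ∀ K ∈ Icc 1 (4 * p.g), u + K ≠ 0 := fun K hK => by rw [mem_Icc] at hK; exact nz K (by omega) (by omega)
  have huR : ∀ K ∈ p.AR ∪ p.BR, u + K ≠ 0 := fun K hK => hu4 K (mem_Icc.2 (mem_Icc_of_mem h0 (Or.inr hK)))
  have huR2 : ∀ K ∈ p.AR ∪ p.BR, u + 2 + K ≠ 0 := fun K hK => by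
    have hbd := mem_Icc_of_mem h0 (Or.inr hK)
    have := nz (K + 2) (by omega) (by omega); push_cast at this; rwa [add_assoc, add_comm (2:ℚ)]
  obtain ⟨⟨a1, a2, a3, a4, a5⟩, ⟨d1, d2, d3, d4⟩, ⟨e0, e1, e2, e3, e4, e5, e6⟩, ⟨g1, g2⟩⟩ := lattice_ne h0 hb hu6
  -- the four values
  set F0 := p.vR.eval u with hF0
  set F0' := p.vR.eval (u + 2) with hF0'
  have r1 := vR_ratio_atoms h0 1 h1 hu6
  have r2 := vR_ratio_atoms h0 2 h2 hu6
  have r3 := vR_ratio_atoms h0 3 h3 hu6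
  rw [← hF0] at r1 r2 r3
  -- the shift and the values of G
  have hS := vR_shift h0 huR huR2
  rw [← hF0, ← hF0'] at hS
  push_cast at hS
  have eG0 := GfAEFR_eq_cert X h0 hb hu6
  have eG2 := GfAEFR_eq_cert X h0 hb (u := u + 2) hu6'
  rw [← hF0] at eG0
  rw [← hF0'] at eG2
  -- non-vanishing of the cleared denominators: every factor is (half of) a lattice form `u + K`
  have hne : ∀ {v : ℚ} {w : ℚ}, v ≠ 0 → w * 2 = v → w ≠ 0 := fun hv h hw => hv (by rw [← h, hw, zero_mul])
  have key := telescope_assembly (F0 := F0) (F0' := F0')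
    (F1 := (p.addAEF 1).vR.eval u) (F2 := (p.addAEF 2).vR.eval u) (F3 := (p.addAEF 3).vR.eval u)
    (c0 := c 0) (c1 := c 1) (c2 := c 2) (c3 := c 3) (s1 := (-1) ^ (1 : ℕ)) (s2 := (-1) ^ (2 : ℕ)) (s3 := (-1) ^ (3 : ℕ))
    (n1 := p.numRb 1 u) (n2 := p.numRb 2 u) (n3 := p.numRb 3 u) (d1 := p.denRb 1 u) (d2 := p.denRb 2 u) (d3 := p.denRb 3 u)
    (tn := p.tnR u) (td := p.tdR u) (cnum := p.cnumR u) (cnumS := p.cnumS2 u) (cden := p.cdenR u) (cdenS := p.cdenS2 u)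
    (x0 := X.eval u) (x1 := X.eval (u + 2))
    r1 r2 r3
    (by unfold tdR tnR; linear_combination hS)
    (denRb_ne_zero h0 hb 1 (by norm_num) hu6) (denRb_ne_zero h0 hb 2 (by norm_num) hu6) (denRb_ne_zero h0 hb 3 (by norm_num) hu6)
    (by unfold tdR; exact (mul_ne_zero (mul_ne_zero (mul_ne_zero (mul_ne_zero (ne_of_eq_of_ne (by ring) a1) (ne_of_eq_of_ne (by ring) a2)) (hne d1 (by ring))) (hne e0 (by ring))) (hne g2 (by ring))))
    (by unfold cdenR; exact (mul_ne_zero (mul_ne_zero (mul_ne_zero (mul_ne_zero (mul_ne_zero (mul_ne_zero (mul_ne_zero (mul_ne_zero (mul_ne_zero (mul_ne_zero (mul_ne_zero (ne_of_eq_of_ne (by ring) a1) (hne d1 (by ring))) (hne e0 (by ring))) (hne e1 (by ring))) (ne_of_eq_of_ne (by ring) a2)) (hne d2 (by ring))) (hne e2 (by ring))) (hne e3 (by ring))) (ne_of_eq_of_ne (by ring) a3)) (hne d3 (by ring))) (hne e4 (by ring))) (hne e5 (by ring))))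
    (by unfold cdenS2 cdenR; exact (mul_ne_zero (mul_ne_zero (mul_ne_zero (mul_ne_zero (mul_ne_zero (mul_ne_zero (mul_ne_zero (mul_ne_zero (mul_ne_zero (mul_ne_zero (mul_ne_zero (ne_of_eq_of_ne (by ring) a3) (hne d2 (by ring))) (hne e1 (by ring))) (hne e2 (by ring))) (ne_of_eq_of_ne (by ring) a4)) (hne d3 (by ring))) (hne e3 (by ring))) (hne e4 (by ring))) (ne_of_eq_of_ne (by ring) a5)) (hne d4 (by ring))) (hne e5 (by ring))) (hne e6 (by ring))))
    (hc u)
  rw [eG2, eG0, key]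
  unfold certAEFR cnumS2 cdenS2
  ring

/-! ### Step (3): the DATA identity -/

/-- **Data identity** `Σ_k C_k·vR(p+kδ_aef) = S²G − G` (Lemma U over `SaefR`). -/
theorem dataId_aefR {c : Fin 4 → ℚ} {X : ℚ[X]} (hc : p.IdRb c X) (hb : p.AefBox)
    (h0 : p.Omega) (h1 : (p.addAEF 1).Omega) (h2 : (p.addAEF 2).Omega) (h3 : (p.addAEF 3).Omega) :
    PF.comb4 c ![p.vR, (p.addAEF 1).vR, (p.addAEF 2).vR, (p.addAEF 3).vR]
      = (p.GfAEFR X).shift.shift.add ((p.GfAEFR X).smul (-1)) := by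
  have hp := h0.pos
  obtain ⟨b1, b2, b3, b4, b5, b6, b7, b8, b9, b10, b11, b12⟩ := id hb
  have hIcc : ∀ q : Pt, q.Omega → q.g = p.g → q.vR.poles ⊆ p.SaefR := fun q hq hqg K hK => by
    have := mem_Icc.1 (poles_vR_Icc hq hK); unfold SaefR; rw [mem_Icc]; omega
  refine PF.eq_of_eval_eq_on _ _ p.SaefR ?_ ?_ fun u hu => ?_
  · refine (PF.poles_comb4_subset _ _).trans (union_subset (union_subset ?_ ?_) (union_subset ?_ ?_)) <;>
      simp only [Matrix.cons_val_zero, Matrix.cons_val_one, Matrix.cons_val_two, Matrix.cons_val_three,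
        Matrix.head_cons, Matrix.tail_cons]
    · exact hIcc p h0 rfl
    · exact hIcc _ h1 rfl
    · exact hIcc _ h2 rfl
    · exact hIcc _ h3 rfl
  · have hG : (p.GfAEFR X).poles ⊆ Icc 1 (4 * p.g) := fun K hK =>
      mem_Icc.2 (mem_Icc_of_mem_aef h0 hb (PF.poles_ofFrac _ _ _ hK))
    refine (PF.poles_shift2_sub_subset _).trans (union_subset ?_ (hG.trans fun K hK => ?_))
    · intro K hK
      obtain ⟨j, hj, rfl⟩ := mem_image.1 hK
      obtain ⟨i, hi, rfl⟩ := mem_image.1 hj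
      have := mem_Icc.1 (hG hi); unfold SaefR; rw [mem_Icc]; omega
    · have := mem_Icc.1 hK; unfold SaefR; rw [mem_Icc]; omega
  · rw [PF.eval_comb4, PF.eval_shift2_sub, Fin.sum_univ_four]
    simp only [Matrix.cons_val_zero, Matrix.cons_val_one, Matrix.cons_val_two, Matrix.cons_val_three,
      Matrix.head_cons, Matrix.tail_cons]
    exact funId_aefR hc hb h0 h1 h2 h3 hu

/-! ### Step (4): legitimacy at the common node `M* = −(a+3)` -/

/-- At `u = −(a+3)` and `u = −(a+2)` the telescoped function has simple zeros (from `block(a+2, 2a−2b+2)`, using `a ≥ 2b+2`) and no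
pole (`2e > a+3`, `2a > a+3` on the box): all four formal residues vanish. -/
theorem GfAEFR_altRes (X : ℚ[X]) (h : p.Omega) (hb : p.AefBox) :
    altRes0 (-(p.a + 3)) (p.GfAEFR X) = 0 ∧ altRes0 (-(p.a + 3) + 1) (p.GfAEFR X) = 0 ∧
      altRes1 (-(p.a + 3)) (p.GfAEFR X) = 0 ∧ altRes1 (-(p.a + 3) + 1) (p.GfAEFR X) = 0 := by
  obtain ⟨o1, o2, o3, o4, o5, o6, o7, o8, o9⟩ := h
  obtain ⟨b1, b2, b3, b4, b5, b6, b7, b8, b9, b10, b11, b12⟩ := hb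
  have hm : ∀ k ∈ p.AGf ∪ p.BG, twoRange p.AGf p.BG k = 1 ∨ twoRange p.AGf p.BG k = 2 := fun _ hk => twoRange_mem hk
  have hnot : ∀ K : ℤ, K ≤ p.a + 3 → K ∉ p.AGf ∪ p.BG := fun K hK hmem => by
    rcases mem_union.1 hmem with h | h
    · obtain ⟨i, h1, h2, h3⟩ := mem_AGf.1 h; omega
    · obtain ⟨i, h1, h2, h3⟩ := mem_BG.1 h; omega
  have hdvd : ∀ K : ℤ, p.a + 2 ≤ K → K < 2 * p.a - 2 * p.b + 2 → lin K ∣ p.NGAEFR X := fun K h1 h2 => by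
    unfold NGAEFR
    exact (((((lin_dvd_block h1 h2).mul_right _).mul_right _).mul_right _).mul_left _).mul_right _
  have e1 : -(-(p.a + 3)) = p.a + 3 := by ring
  have e2 : -(-(p.a + 3) + 1) = p.a + 2 := by ring
  unfold GfAEFR
  refine ⟨?_, ?_, ?_, ?_⟩
  · rw [altRes0_eq_eval]
    refine mul_eq_zero_of_right _ ?_
    exact PF.eval_ofFrac_eq_zero_of_dvd _ _ (p.NGAEFR X) hm (M := -(p.a + 3)) (by rw [e1]; exact hnot _ le_rfl)
      (by rw [e1]; exact hdvd _ (by omega) (by omega))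
  · rw [altRes0_eq_eval]
    refine mul_eq_zero_of_right _ ?_
    exact PF.eval_ofFrac_eq_zero_of_dvd _ _ (p.NGAEFR X) hm (M := -(p.a + 3) + 1) (by rw [e2]; exact hnot _ (by omega))
      (by rw [e2]; exact hdvd _ (by omega) (by omega))
  · exact altRes1_ofFrac_eq_zero _ _ _ (by rw [e1]; exact hnot _ le_rfl)
  · exact altRes1_ofFrac_eq_zero _ _ _ (by rw [e2]; exact hnot _ (by omega))

/-! ### Step (5): node moves -/

/-- Along `δ_aef` (`0 ≤ k ≤ 3`) on the box: the own second-tale node of `p+kδ` lies left of `−(a+3)` and the move is inside its window. -/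
theorem altE_nodes_aefR (hb : p.AefBox) {k : ℤ} (hk : (p.addAEF k).Omega) (hk0 : 0 ≤ k) (hk3 : k ≤ 3) (d : ℕ) :
    altE0 d (p.addAEF k).nodeR (p.addAEF k).vR = altE0 d (-(p.a + 3)) (p.addAEF k).vR ∧
      altE1 (p.addAEF k).nodeR (p.addAEF k).vR = altE1 (-(p.a + 3)) (p.addAEF k).vR := by
  obtain ⟨b1, b2, b3, b4, b5, b6, b7, b8, b9, b10, b11, b12⟩ := hb
  have hn : (p.addAEF k).nodeR = 1 - a0star (p.addAEF k).t2a := rfl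
  have ha0 := a0star_t2a_eq hk
  simp only [addAEF_a, addAEF_b, addAEF_e, addAEF_f, addAEF_g] at ha0
  refine altE_nodeR_to hk _ d ?_ ?_
  · rw [hn, ha0]
    rcases le_total (p.e + k) (p.f + k) with hef | hef
    · rw [max_eq_right hef]; omega
    · rw [max_eq_left hef]; omega
  · rw [addAEF_a]; omega

/-! ### Step (6): the second-tale recurrence of direction `aef` -/

/-- **Direction `aef`, second tale, generic certificate (on the rule box).** For `p, p+δ, p+2δ, p+3δ ∈ Ω` (`δ = δ_aef`) with `p` in the aef
rule box, an R-side operator `c` and a certificate polynomial `X` (`deg ≤ 9`) satisfying `IdRb c X p`: the second-tale functionals at their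
own nodes satisfy the operator `c` (truncation `0`). -/
theorem recR_aef {c : Fin 4 → ℚ} {X : ℚ[X]} (hX : X.natDegree ≤ 9) (hc : p.IdRb c X) (hb : p.AefBox)
    (h0 : p.Omega) (h1 : (p.addAEF 1).Omega) (h2 : (p.addAEF 2).Omega) (h3 : (p.addAEF 3).Omega) :
    (c 0 * altE1 p.nodeR p.vR + c 1 * altE1 (p.addAEF 1).nodeR (p.addAEF 1).vR
      + c 2 * altE1 (p.addAEF 2).nodeR (p.addAEF 2).vR + c 3 * altE1 (p.addAEF 3).nodeR (p.addAEF 3).vR = 0) ∧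
    (c 0 * altE0 0 p.nodeR p.vR + c 1 * altE0 0 (p.addAEF 1).nodeR (p.addAEF 1).vR
      + c 2 * altE0 0 (p.addAEF 2).nodeR (p.addAEF 2).vR + c 3 * altE0 0 (p.addAEF 3).nodeR (p.addAEF 3).vR = 0) := by
  have hdata := dataId_aefR hc hb h0 h1 h2 h3
  have hres := GfAEFR_altRes X h0 hb
  have e00 : p.addAEF 0 = p := by cases p; simp [addAEF]
  have h0' : (p.addAEF 0).Omega := by rw [e00]; exact h0
  have m0 := altE_nodes_aefR hb h0' le_rfl (by norm_num) 0
  rw [e00] at m0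
  have m1 := altE_nodes_aefR hb h1 (by norm_num) (by norm_num) 0
  have m2 := altE_nodes_aefR hb h2 (by norm_num) (by norm_num) 0
  have m3 := altE_nodes_aefR hb h3 (by norm_num) (by norm_num) 0
  have s1 := altE1_step2 (-(p.a + 3)) c _ (p.GfAEFR X) hdata
  have s0 := altE0_step2 0 (-(p.a + 3)) c _ (p.GfAEFR X) hdata (natDegree_GfAEFR_le X hX h0 hb)
  rw [Fin.sum_univ_four] at s1 s0
  simp only [Matrix.cons_val_zero, Matrix.cons_val_one, Matrix.cons_val_two, Matrix.cons_val_three,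
    Matrix.head_cons, Matrix.tail_cons] at s1 s0
  rw [hres.2.2.1, hres.2.2.2] at s1
  rw [hres.1, hres.2.1] at s0
  rw [m0.2, m1.2, m2.2, m3.2, m0.1, m1.1, m2.1, m3.1]
  constructor
  · linarith
  · linarith

end Pt

end Summit.KontsevichZagierPeriods.Zeta5Search.TwoTaleOmega

end
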